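import Literature.NumberTheory.GaloisRepresentations.ContinuousCharactersAbelianization
import Mathlib.Algebra.Module.CharacterModule
import Mathlib.Topology.Algebra.ClopenNhdofOne
import HarnessLib

/-!
# Continuous characters `G → ℚ/ℤ` separate the points of `G^ab` (profinite `G`);
# `closure [G, G] = ⋂ ker χ = ⋂_{c ∈ H²(G, ℤ)} ker χ_c`

Topic `NumberTheory/GaloisRepresentations`; namespace `Literature.NumberTheory.GaloisRepresentations`.
Theorems only (no definition, no named fact).  For a profinite group `G` and `g ∉ closure [G, G]`
there is a continuous character `χ : G → ℚ/ℤ` (a continuous `1`-cocycle of the trivial discrete module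
`QModZCoeff`) with `χ(g) ≠ 0`: an open normal subgroup `U` with `g ∉ U · closure [G, G]` exists
(`ProfiniteGrp.exist_openNormalSubgroup_sub_open_nhds_of_one`), the finite abelian group
`G ⧸ (U ⊔ closure [G, G])` has a `ℚ/ℤ`-valued character not vanishing at `ḡ` (Mathlib
`CharacterModule.exists_character_apply_ne_zero_of_ne_zero`, divisibility of `ℚ/ℤ`), and its
pull-back to `G` is continuous (the quotient is discrete).

* **`exists_character_apply_ne_zero`**;
* `mem_commutatorClosure_iff_forall_character` — `g ∈ closure [G,G] ↔ χ(g) = 0` for all `χ`;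
* `mem_commutatorClosure_iff_forall_H2Int` — the same through `H²(G, ℤ) ≅ Hom_cont(G, ℚ/ℤ)`
  (`H2IntEquivHom`): **`H²(G, ℤ)` detects `G^ab`**;
* `exists_character_apply_ne_zero_of_ne_one`, `eq_of_forall_character_apply_eq`,
  `eq_one_iff_forall_H2Int` — for a profinite ABELIAN group the continuous characters (equivalently
  the classes of `H²(G, ℤ)`) separate points (Pontryagin duality: injectivity of `G → G^∨∨`).

Honest framing: classical; nothing here bears on abc or takes a side on [IUTchIII] Cor. 3.12.

## References
* J.-P. Serre, *Local Fields* (1979), XIII §1; L. S. Pontryagin / Hewitt–Ross, *Abstract Harmonic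
  Analysis* I (24.3) for the duality background. [SerreLocalFields1979]
-/

noncomputable section

open CategoryTheory Function
open scoped Pointwise commutatorElement

universe u

namespace Literature.NumberTheory.GaloisRepresentations

open _root_.TopRep _root_.ContRepresentation _root_.ContinuousCohomology _root_.Topology

section SeparatePoints

variable {G : Type u} [Group G] [TopologicalSpace G] [IsTopologicalGroup G] [CompactSpace G]
  [T2Space G] [TotallyDisconnectedSpace G]

omit [T2Space G] in
/-- **Continuous `ℚ/ℤ`-valued characters separate the points of `G^ab`**: for `G` profinite and
`g ∉ closure [G, G]` there is a continuous character `χ : G → ℚ/ℤ` with `χ(g) ≠ 0`.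
[cite: SerreLocalFields1979, XIII §1] -/
theorem exists_character_apply_ne_zero {g : G} (hg : g ∉ (commutator G).topologicalClosure) :
    ∃ χ : contOneCocycles (ContinuousRep.trivial G ℤ QModZCoeff.{u}).toTopRep, χ.1 g ≠ 0 := by
  set C := (commutator G).topologicalClosure with hC
  -- an open normal `U` with `U g ∩ C = ∅`
  have hVopen : IsOpen ((fun u : G => u * g) ⁻¹' ((C : Set G)ᶜ)) :=
    (Subgroup.isClosed_topologicalClosure _).isOpen_compl.preimage (continuous_id.mul continuous_const)
  have h1V : (1 : G) ∈ (fun u : G => u * g) ⁻¹' ((C : Set G)ᶜ) := by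
    rw [Set.mem_preimage, one_mul]; exact hg
  obtain ⟨U, hU⟩ := ProfiniteGrp.exist_openNormalSubgroup_sub_open_nhds_of_one hVopen h1V
  -- `H = U ⊔ C`, an open normal subgroup containing the commutators and missing `g`
  set H : Subgroup G := (U : Subgroup G) ⊔ C with hH
  haveI : H.Normal := Subgroup.sup_normal _ _
  have hHopen : IsOpen (H : Set G) := Subgroup.isOpen_mono le_sup_left U.isOpen'
  have hgH : g ∉ H := by
    intro hmem
    have hmem' : g ∈ ((U : Subgroup G) : Set G) * (C : Set G) := by
      rw [← Subgroup.mul_normal]; exact hmem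
    obtain ⟨u, hu, c, hc, huc⟩ := hmem'
    have hu' : u⁻¹ ∈ (fun u : G => u * g) ⁻¹' ((C : Set G)ᶜ) := hU (U.inv_mem' hu)
    rw [Set.mem_preimage, Set.mem_compl_iff] at hu'
    apply hu'
    have : u⁻¹ * g = c := by rw [← huc, inv_mul_cancel_left]
    rw [this]; exact hc
  -- the finite abelian discrete quotient `Q = G ⧸ H`
  haveI : DiscreteTopology (G ⧸ H) := QuotientGroup.discreteTopology hHopen
  letI : CommGroup (G ⧸ H) :=
    { mul_comm := fun x y => Quotient.inductionOn₂' x y fun a b => Quotient.sound' <|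
        QuotientGroup.leftRel_apply.mpr <| by
          have h : (a * b)⁻¹ * (b * a) = ⁅b⁻¹, a⁻¹⁆ := by group
          rw [h]
          exact le_sup_right.trans (le_refl H) (Subgroup.le_topologicalClosure _
            (Subgroup.commutator_mem_commutator (Subgroup.mem_top b⁻¹) (Subgroup.mem_top a⁻¹)))
      __ := (inferInstance : Group (G ⧸ H)) }
  have hne : Additive.ofMul (QuotientGroup.mk g : G ⧸ H) ≠ 0 := by
    intro h0
    apply hgH
    rw [← QuotientGroup.eq_one_iff]
    exact Additive.ofMul.injective h0
  obtain ⟨c, hc⟩ := CharacterModule.exists_character_apply_ne_zero_of_ne_zero hne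
  -- pull the character back to `G`
  refine ⟨⟨⟨fun x => ULift.up (c (Additive.ofMul (QuotientGroup.mk x : G ⧸ H))), by
      exact (continuous_of_discreteTopology (β := QModZCoeff.{u})
        (f := fun q : G ⧸ H => ULift.up (c (Additive.ofMul q)))).comp
          (QuotientGroup.continuous_mk (N := H))⟩, fun a b => ?_⟩, ?_⟩
  · change ULift.up (c (Additive.ofMul (QuotientGroup.mk (a * b) : G ⧸ H))) =
      ULift.up (c (Additive.ofMul (QuotientGroup.mk a : G ⧸ H))) +
        ULift.up (c (Additive.ofMul (QuotientGroup.mk b : G ⧸ H)))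
    rw [QuotientGroup.mk_mul, ofMul_mul, map_add]
    rfl
  · intro h0
    exact hc (congrArg ULift.down h0)

omit [T2Space G] in
/-- **`closure [G, G] = ⋂_χ ker χ`**: `g ∈ closure [G, G]` iff every continuous character
`χ : G → ℚ/ℤ` vanishes at `g`. [cite: SerreLocalFields1979, XIII §1] -/
theorem mem_commutatorClosure_iff_forall_character (g : G) :
    g ∈ (commutator G).topologicalClosure ↔
      ∀ χ : contOneCocycles (ContinuousRep.trivial G ℤ QModZCoeff.{u}).toTopRep, χ.1 g = 0 :=
  ⟨fun hg χ => (mem_oneCocycleKer_iff χ g).mp (commutatorClosure_le_oneCocycleKer χ hg),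
    fun h => by_contra fun hg => (exists_character_apply_ne_zero hg).elim fun χ hχ => hχ (h χ)⟩

/-- **`H²(G, ℤ)` detects `G^ab`**: `g ∈ closure [G, G]` iff `χ_c(g) = 0` for every `c ∈ H²(G, ℤ)`,
`χ_c = H2IntEquivHom G c` its character. [cite: SerreLocalFields1979, XIII §1] -/
theorem mem_commutatorClosure_iff_forall_H2Int (g : G) :
    g ∈ (commutator G).topologicalClosure ↔
      ∀ c : continuousCohomology 2 (ContinuousRep.trivial G ℤ ZCoeff.{u}).toTopRep,
        (H2IntEquivHom G c).1 g = 0 := by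
  rw [mem_commutatorClosure_iff_forall_character]
  refine ⟨fun h c => h _, fun h χ => ?_⟩
  rw [← (H2IntEquivHom G).apply_symm_apply χ]
  exact h _

omit [T2Space G] in
/-- Two elements with the same values under all continuous characters are congruent modulo
`closure [G, G]`. [cite: SerreLocalFields1979, XIII §1] -/
theorem inv_mul_mem_commutatorClosure_of_forall_character {g g' : G}
    (h : ∀ χ : contOneCocycles (ContinuousRep.trivial G ℤ QModZCoeff.{u}).toTopRep, χ.1 g = χ.1 g') :
    g⁻¹ * g' ∈ (commutator G).topologicalClosure := by
  rw [mem_commutatorClosure_iff_forall_character]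
  intro χ
  rw [contOneCocycles.apply_mul_of_trivial (fun _ _ => rfl), contOneCocycles.apply_inv]
  change -(χ.1 g) + χ.1 g' = 0
  rw [h χ, neg_add_cancel]

end SeparatePoints

section CommGroup

variable {G : Type u} [CommGroup G] [TopologicalSpace G] [IsTopologicalGroup G] [CompactSpace G]
  [T2Space G] [TotallyDisconnectedSpace G]

omit [CompactSpace G] [TotallyDisconnectedSpace G] in
/-- In a Hausdorff abelian group, `closure [G, G] = ⊥`. [cite: SerreLocalFields1979, XIII §1] -/
theorem commutatorClosure_eq_bot : (commutator G).topologicalClosure = ⊥ := by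
  have h : commutator G = ⊥ := by
    rw [commutator_eq_closure, Subgroup.closure_eq_bot_iff]
    rintro x ⟨a, b, rfl⟩
    exact commutatorElement_eq_one_iff_mul_comm.mpr (mul_comm a b)
  rw [h]
  refine (Subgroup.eq_bot_iff_forall _).mpr fun x hx => ?_
  have hx' : x ∈ closure (((⊥ : Subgroup G) : Set G)) := by
    rw [← Subgroup.topologicalClosure_coe]; exact hx
  rwa [Subgroup.coe_bot, closure_singleton, Set.mem_singleton_iff] at hx'

/-- **Continuous characters separate the points of a profinite abelian group** (Pontryagin duality:
`G → G^∨∨` is injective): `g ≠ 1 ⇒ χ(g) ≠ 0` for some continuous `χ : G → ℚ/ℤ`.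
[cite: SerreLocalFields1979, XIII §1] -/
theorem exists_character_apply_ne_zero_of_ne_one {g : G} (hg : g ≠ 1) :
    ∃ χ : contOneCocycles (ContinuousRep.trivial G ℤ QModZCoeff.{u}).toTopRep, χ.1 g ≠ 0 :=
  exists_character_apply_ne_zero (by rw [commutatorClosure_eq_bot, Subgroup.mem_bot]; exact hg)

/-- **A profinite abelian group element is determined by its character values.**
[cite: SerreLocalFields1979, XIII §1] -/
theorem eq_of_forall_character_apply_eq {g g' : G}
    (h : ∀ χ : contOneCocycles (ContinuousRep.trivial G ℤ QModZCoeff.{u}).toTopRep, χ.1 g = χ.1 g') :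
    g = g' := by
  have hmem := inv_mul_mem_commutatorClosure_of_forall_character h
  rw [commutatorClosure_eq_bot, Subgroup.mem_bot, inv_mul_eq_one] at hmem
  exact hmem

/-- **`H²(G, ℤ)` separates the points of a profinite abelian group**: `g = 1` iff `χ_c(g) = 0` for
all `c ∈ H²(G, ℤ)`. [cite: SerreLocalFields1979, XIII §1] -/
theorem eq_one_iff_forall_H2Int (g : G) :
    g = 1 ↔ ∀ c : continuousCohomology 2 (ContinuousRep.trivial G ℤ ZCoeff.{u}).toTopRep,
      (H2IntEquivHom G c).1 g = 0 := by
  rw [← Subgroup.mem_bot, ← commutatorClosure_eq_bot]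
  exact mem_commutatorClosure_iff_forall_H2Int g

end CommGroup

/-! ### `H²(G, ℤ) = 0` iff `G` is topologically perfect -/

section Perfect

variable {G : Type u} [Group G] [TopologicalSpace G] [IsTopologicalGroup G] [CompactSpace G]
  [T2Space G] [TotallyDisconnectedSpace G]

omit [T2Space G] in
/-- **Every continuous `ℚ/ℤ`-character of a profinite group vanishes iff `closure [G, G] = G`.**
[cite: SerreLocalFields1979, XIII §1] -/
theorem forall_character_eq_zero_iff_commutatorClosure_eq_top :
    (∀ χ : contOneCocycles (ContinuousRep.trivial G ℤ QModZCoeff.{u}).toTopRep, χ = 0) ↔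
      (commutator G).topologicalClosure = ⊤ := by
  constructor
  · intro h
    rw [eq_top_iff]
    intro g _
    rw [mem_commutatorClosure_iff_forall_character]
    intro χ
    rw [h χ]
    rfl
  · intro h χ
    refine Subtype.ext (ContinuousMap.ext fun g => ?_)
    have hg : g ∈ (commutator G).topologicalClosure := h ▸ Subgroup.mem_top g
    exact (mem_oneCocycleKer_iff χ g).mp (commutatorClosure_le_oneCocycleKer χ hg)

/-- **`H²(G, ℤ) = 0` iff `G` is topologically perfect** (`closure [G, G] = G`), for `G` profinite:
`H²(G, ℤ) ≅ Hom_cont(G, ℚ/ℤ)` and characters separate the points of `G^ab`.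
[cite: SerreLocalFields1979, XIII §1] -/
theorem subsingleton_continuousCohomology_two_ZCoeff_iff_commutatorClosure_eq_top :
    Subsingleton (continuousCohomology 2 (ContinuousRep.trivial G ℤ ZCoeff.{u}).toTopRep) ↔
      (commutator G).topologicalClosure = ⊤ := by
  rw [← forall_character_eq_zero_iff_commutatorClosure_eq_top]
  constructor
  · intro h χ
    rw [← (H2IntEquivHom G).apply_symm_apply χ, Subsingleton.elim ((H2IntEquivHom G).symm χ) 0,
      map_zero]
  · intro h
    refine ⟨fun c₁ c₂ => (H2IntEquivHom G).injective ?_⟩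
    rw [h (H2IntEquivHom G c₁), h (H2IntEquivHom G c₂)]

end Perfect

/-! ### The title formula as a subgroup identity -/

section IInf

variable {G : Type u} [Group G] [TopologicalSpace G] [IsTopologicalGroup G] [CompactSpace G]
  [TotallyDisconnectedSpace G]

/-- **`closure [G, G] = ⋂_χ ker χ`** as an equality of subgroups, `χ` over the continuous
`ℚ/ℤ`-characters of the profinite group `G` (the subgroup form of
`mem_commutatorClosure_iff_forall_character`; recorded at the request of the RQ7 audit of p427134).
[cite: SerreLocalFields1979, XIII §1] -/
theorem commutatorClosure_eq_iInf_oneCocycleKer :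
    (commutator G).topologicalClosure =
      ⨅ χ : contOneCocycles (ContinuousRep.trivial G ℤ QModZCoeff.{u}).toTopRep, oneCocycleKer χ := by
  ext g
  rw [mem_commutatorClosure_iff_forall_character, Subgroup.mem_iInf]
  exact forall_congr' fun χ => (mem_oneCocycleKer_iff χ g).symm

/-- **`⋂_{c ∈ H²(G, ℤ)} ker χ_c = closure [G, G]`** (`G` profinite), through `H2IntEquivHom`.
[cite: SerreLocalFields1979, XIII §1] -/
theorem commutatorClosure_eq_iInf_oneCocycleKer_H2Int [T2Space G] :
    (commutator G).topologicalClosure =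
      ⨅ c : continuousCohomology 2 (ContinuousRep.trivial G ℤ ZCoeff.{u}).toTopRep,
        oneCocycleKer (H2IntEquivHom G c) := by
  ext g
  rw [mem_commutatorClosure_iff_forall_H2Int, Subgroup.mem_iInf]
  exact forall_congr' fun c => (mem_oneCocycleKer_iff _ g).symm

end IInf

end Literature.NumberTheory.GaloisRepresentations

end
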